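import Summits.CriticalPhenomena.Ising3DConformalLimit.Theorems.FKParityRobustnessIndependentStrandsJoinStubTreeFloor
import Summits.CriticalPhenomena.Ising3DConformalLimit.Theorems.FKParityRobustnessIndependentStrandsJoinStubBubble
import Literature.Probability.LatticeModels.IntersectionPropertyLatticePrelim
import Literature.Probability.LatticeModels.CriticalTwoPointLower
import HarnessLib

/-!
# Crux `IndependentStrandsJoin` (stmt-CriticalPhenomena-14625), reshape R1 ("single-current second moment") —
# glue stub `stub_twoPointInputs`: the landed conditional window tree floor and window bubble in `⟨σσ⟩^free_{Λ_N}` form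

Route `FKParityRobustness`, sub-problem `Ising3DConformalLimit`; `--supports` file of the registered glue stub
`stub_twoPointInputs` of the reshape skeleton R1 of the line `cross-fattening-decoupling` (lead c1-0).  The two
two-point inputs of the Aizenman–Duminil-Copin second-moment template (Ann. of Math. 194 (2021), Lemma 4.4) are
LANDED conditionally on the named regularity fact `HasIsingEtaBounds 3 η` in loop-O(1) form, over the vocabulary
`zPair`, `profile`, `treePair`, `bubbleSum`, `window` of `…CrossFatteningDefs.lean`:

* `stub_treeFloor_of_etaBounds` (`…StubTreeFloor.lean`): `c·(Z^∅)²·Z^{a₀a₁}·Z^{a₂a₃} ≤ profile` (`η ≤ 1/2`);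
* `stub_bubble_of_etaBounds` (`…StubBubble.lean`): `Z^{a₀a₁}·Z^{a₂a₃}·bubbleSum ≤ C·profile²` (`0 ≤ η < 1/2`).

This file rewrites them with the free box two-point function `τ_N(x,y) = ⟨σ_xσ_y⟩^free_{Λ_N,β_c}` of the induced
box graph `G_N = (zdGraph 3).comap Subtype.val` (`isingTwoPoint G_N univ β_c 0 free`), using the dictionary
`zPair x y = Z^{{x}∆{y}} = Z^∅·τ_N(x,y)` for ALL `x, y` (`tpi_zPair_eq`: for `x ≠ y` the high-temperature
expansion `twoPoint_eq_loopO1_div`, for `x = y` both sides are `Z^∅` since `⟨σ_xσ_x⟩ = 1`), so that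
`profile = (Z^∅)⁴·Σ_u τ⁴`, `bubbleSum = (Z^∅)⁶·Σ_{u,v} T₁T₂`, `(Z^∅)²Z^{a₀a₁}Z^{a₂a₃} = (Z^∅)⁴·τ₀₁τ₂₃`, and divides
by `(Z^∅)⁴ > 0`, `(Z^∅)⁸ > 0`.  It adds the three elementary facts the R1 composition consumes: `τ_N ≥ 0`
(indeed `τ_N > 0`: the box is connected and `β_c > 0`, `isingTwoPoint_box_pos` transported by `twoPoint_boxComap`),
`τ_N(a₀,a₁), τ_N(a₂,a₃) > 0`, and the pair dictionary `τ_N(x,y) = ⟨σ_{{x,y}}⟩` for `x ≠ y`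
(`isingTwoPoint_eq_isingCorr`; `a` is injective, `tetra_injective`).  `0 ≤ η` is forced
(`StubTreeFloor.treeFloor_eta_nonneg`), so the hypotheses are `HasIsingEtaBounds 3 η`, `η < 1/2` only.

The statement of `stub_twoPointInputs` is the registered `let`-free spelling (all vocabulary inlined over tree
declarations); helpers carry the prefix `tpi_` in the sub-namespace `…Theorems.TwoPointInputs`.  Theorem-only file.

References: M. Aizenman, H. Duminil-Copin, Ann. of Math. 194 (2021), arXiv:1912.07973, §4, Lemma 4.4
[AizenmanDuminilCopinAnnals2021]; S. Friedli, Y. Velenik, *Statistical Mechanics of Lattice Systems*, CUP 2017, §3.7.3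
(`⟨σ_xσ_y⟩ = Z^{xy}/Z^∅`), Thm. 3.20 (GKS) [FriedliVelenik2017]; H. Duminil-Copin, lecture notes 2016, §2.1
(currents along paths, positivity) [DuminilCopin2016].
-/

noncomputable section

open Finset
open Literature.Probability.LatticeModels
open Summit.CriticalPhenomena.Ising3DConformalLimit.Cruxes.ParityRobustMerging.PlaquetteXorSurgery
  (tetra tetra_injective tanh_criticalBeta_nonneg)
open Summit.CriticalPhenomena.Ising3DConformalLimit.Cruxes.IndependentStrandsJoin.CrossFatteningDecoupling
open Summit.CriticalPhenomena.Ising3DConformalLimit.FKParityRobustnessLatticeBoundFromStrands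
  (twoPoint_eq_loopO1_div twoPoint_boxComap)

namespace Summit.CriticalPhenomena.Ising3DConformalLimit.Theorems

namespace TwoPointInputs

open scoped symmDiff

variable {N : ℕ}

/-- The free two-point function of the induced box graph is the free finite-volume two-point function of `ℤ³`
in the box: `⟨σ_xσ_y⟩^free_{G_N} = ⟨σ_xσ_y⟩^free_{Λ_N}` (`twoPoint_boxComap`). -/
theorem tpi_tau_eq_box (x y : ↥(box 3 N)) :
    isingTwoPoint ((zdGraph 3).comap (Subtype.val : ↥(box 3 N) → Site 3)) Finset.univ (criticalBeta 3) 0 .free x y =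
      isingTwoPoint (zdGraph 3) (box 3 N) (criticalBeta 3) 0 .free (x : Site 3) y := by
  have h := twoPoint_boxComap (box 3 N) (criticalBeta 3) x y
  simpa only [twoPoint_isingMeasure] using h

/-- **Positivity** `⟨σ_xσ_y⟩^free_{Λ_N,β_c} > 0` for all `x, y` in the box (the box is connected and
`β_c(3) > 0`, `criticalBeta_pos_holds`; `isingTwoPoint_box_pos`). -/
theorem tpi_tau_pos (x y : ↥(box 3 N)) :
    0 < isingTwoPoint ((zdGraph 3).comap (Subtype.val : ↥(box 3 N) → Site 3)) Finset.univ (criticalBeta 3) 0 .free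
      x y := by
  rw [tpi_tau_eq_box]
  exact isingTwoPoint_box_pos (criticalBeta_pos_holds (d := 3) (by norm_num)) x y

/-- `Z^∅_N > 0` at `t = tanh β_c`. -/
theorem tpi_Z0_pos :
    0 < loopO1PartitionFunction ((zdGraph 3).comap (Subtype.val : ↥(box 3 N) → Site 3)) (Real.tanh (criticalBeta 3))
      ∅ :=
  loopO1PartitionFunction_empty_pos _ tanh_criticalBeta_nonneg

/-- **The pair dictionary with cleared denominator**, `x ≠ y`: `Z^{xy}_N = Z^∅_N · ⟨σ_xσ_y⟩^free_{Λ_N,β_c}`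
(high-temperature expansion `twoPoint_eq_loopO1_div` on the induced box graph). -/
theorem tpi_pair_eq {x y : ↥(box 3 N)} (hxy : x ≠ y) :
    loopO1PartitionFunction ((zdGraph 3).comap (Subtype.val : ↥(box 3 N) → Site 3)) (Real.tanh (criticalBeta 3))
        {x, y} =
      loopO1PartitionFunction ((zdGraph 3).comap (Subtype.val : ↥(box 3 N) → Site 3)) (Real.tanh (criticalBeta 3)) ∅ *
        isingTwoPoint ((zdGraph 3).comap (Subtype.val : ↥(box 3 N) → Site 3)) Finset.univ (criticalBeta 3) 0 .free
          x y := by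
  have h := twoPoint_eq_loopO1_div (G := (zdGraph 3).comap (Subtype.val : ↥(box 3 N) → Site 3))
    (criticalBeta_nonneg 3) hxy
  rw [twoPoint_isingMeasure] at h
  rw [h, mul_div_cancel₀ _ tpi_Z0_pos.ne']

/-- **`zPair = Z^∅ · τ_N` for ALL pairs**: `Z^{{x}∆{y}}_N = Z^∅_N · ⟨σ_xσ_y⟩^free_{Λ_N,β_c}` (for `x = y` both sides
are `Z^∅_N`, `⟨σ_xσ_x⟩ = 1`; for `x ≠ y` this is `tpi_pair_eq`). -/
theorem tpi_zPair_eq (x y : ↥(box 3 N)) :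
    zPair ((zdGraph 3).comap (Subtype.val : ↥(box 3 N) → Site 3)) (Real.tanh (criticalBeta 3)) x y =
      loopO1PartitionFunction ((zdGraph 3).comap (Subtype.val : ↥(box 3 N) → Site 3)) (Real.tanh (criticalBeta 3)) ∅ *
        isingTwoPoint ((zdGraph 3).comap (Subtype.val : ↥(box 3 N) → Site 3)) Finset.univ (criticalBeta 3) 0 .free
          x y := by
  by_cases hxy : x = y
  · subst hxy
    rw [zPair, symmDiff_self, Finset.bot_eq_empty, isingTwoPoint_self, mul_one]
  · rw [zPair, Current.symmDiff_singleton_eq_pair hxy, tpi_pair_eq hxy]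

/-- The window profile in `τ_N` form: `profile = (Z^∅)⁴ · Σ_{u ∈ B} τ(a₀u)τ(ua₁)τ(a₂u)τ(ua₃)`. -/
theorem tpi_profile_eq (a : Fin 4 → ↥(box 3 N)) (B : Finset ↥(box 3 N)) :
    profile ((zdGraph 3).comap (Subtype.val : ↥(box 3 N) → Site 3)) (Real.tanh (criticalBeta 3)) a B =
      loopO1PartitionFunction ((zdGraph 3).comap (Subtype.val : ↥(box 3 N) → Site 3)) (Real.tanh (criticalBeta 3))
          ∅ ^ 4 *
        ∑ u ∈ B,
          isingTwoPoint ((zdGraph 3).comap (Subtype.val : ↥(box 3 N) → Site 3)) Finset.univ (criticalBeta 3) 0 .free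
              (a 0) u *
            isingTwoPoint ((zdGraph 3).comap (Subtype.val : ↥(box 3 N) → Site 3)) Finset.univ (criticalBeta 3) 0 .free
              u (a 1) *
            (isingTwoPoint ((zdGraph 3).comap (Subtype.val : ↥(box 3 N) → Site 3)) Finset.univ (criticalBeta 3) 0
                .free (a 2) u *
              isingTwoPoint ((zdGraph 3).comap (Subtype.val : ↥(box 3 N) → Site 3)) Finset.univ (criticalBeta 3) 0
                .free u (a 3)) := by
  unfold profile
  rw [Finset.mul_sum]
  refine Finset.sum_congr rfl fun u _ => ?_
  simp only [tpi_zPair_eq]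
  ring

/-- The window bubble in `τ_N` form: `bubbleSum = (Z^∅)⁶ · Σ_{u,v ∈ B} T₁(u,v)·T₂(u,v)` with the ADC trees
`Tᵢ(u,v) = τ(xu)τ(uv)τ(vy) + τ(xv)τ(vu)τ(uy)`. -/
theorem tpi_bubbleSum_eq (a : Fin 4 → ↥(box 3 N)) (B : Finset ↥(box 3 N)) :
    bubbleSum ((zdGraph 3).comap (Subtype.val : ↥(box 3 N) → Site 3)) (Real.tanh (criticalBeta 3)) a B =
      loopO1PartitionFunction ((zdGraph 3).comap (Subtype.val : ↥(box 3 N) → Site 3)) (Real.tanh (criticalBeta 3))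
          ∅ ^ 6 *
        ∑ u ∈ B, ∑ v ∈ B,
          (isingTwoPoint ((zdGraph 3).comap (Subtype.val : ↥(box 3 N) → Site 3)) Finset.univ (criticalBeta 3) 0 .free
                  (a 0) u *
                isingTwoPoint ((zdGraph 3).comap (Subtype.val : ↥(box 3 N) → Site 3)) Finset.univ (criticalBeta 3) 0
                  .free u v *
                isingTwoPoint ((zdGraph 3).comap (Subtype.val : ↥(box 3 N) → Site 3)) Finset.univ (criticalBeta 3) 0
                  .free v (a 1) +
              isingTwoPoint ((zdGraph 3).comap (Subtype.val : ↥(box 3 N) → Site 3)) Finset.univ (criticalBeta 3) 0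
                  .free (a 0) v *
                isingTwoPoint ((zdGraph 3).comap (Subtype.val : ↥(box 3 N) → Site 3)) Finset.univ (criticalBeta 3) 0
                  .free v u *
                isingTwoPoint ((zdGraph 3).comap (Subtype.val : ↥(box 3 N) → Site 3)) Finset.univ (criticalBeta 3) 0
                  .free u (a 1)) *
            (isingTwoPoint ((zdGraph 3).comap (Subtype.val : ↥(box 3 N) → Site 3)) Finset.univ (criticalBeta 3) 0
                  .free (a 2) u *
                isingTwoPoint ((zdGraph 3).comap (Subtype.val : ↥(box 3 N) → Site 3)) Finset.univ (criticalBeta 3) 0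
                  .free u v *
                isingTwoPoint ((zdGraph 3).comap (Subtype.val : ↥(box 3 N) → Site 3)) Finset.univ (criticalBeta 3) 0
                  .free v (a 3) +
              isingTwoPoint ((zdGraph 3).comap (Subtype.val : ↥(box 3 N) → Site 3)) Finset.univ (criticalBeta 3) 0
                  .free (a 2) v *
                isingTwoPoint ((zdGraph 3).comap (Subtype.val : ↥(box 3 N) → Site 3)) Finset.univ (criticalBeta 3) 0
                  .free v u *
                isingTwoPoint ((zdGraph 3).comap (Subtype.val : ↥(box 3 N) → Site 3)) Finset.univ (criticalBeta 3) 0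
                  .free u (a 3)) := by
  unfold bubbleSum treePair
  rw [Finset.mul_sum]
  refine Finset.sum_congr rfl fun u _ => ?_
  rw [Finset.mul_sum]
  refine Finset.sum_congr rfl fun v _ => ?_
  simp only [tpi_zPair_eq]
  ring

end TwoPointInputs

open TwoPointInputs in
/-- **Registered glue stub `stub_twoPointInputs` of the reshape R1 ("single-current second moment") of the line
`cross-fattening-decoupling` (crux `IndependentStrandsJoin`, stmt-CriticalPhenomena-14625).**  Under the named
regularity fact `HasIsingEtaBounds 3 η` with `η < 1/2`: there are `c₅, C₆ > 0` such that for every `l ≥ 1`, all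
`N ≥ N₀(l)` and the sources `a = l·tetra ⊂ Λ_N`, with `τ = ⟨σσ⟩^free_{Λ_N,β_c}` on the induced box graph and the
central window `B_l = window N l`: all `τ ≥ 0`; `τ(a₀,a₁), τ(a₂,a₃) > 0`; `τ(a₀,a₁) = ⟨σ_{{a₀,a₁}}⟩`,
`τ(a₂,a₃) = ⟨σ_{{a₂,a₃}}⟩`; the window TREE FLOOR `c₅·τ(a₀a₁)τ(a₂a₃) ≤ Σ_{u∈B_l} τ(a₀u)τ(ua₁)τ(a₂u)τ(ua₃)`
(`stub_treeFloor_of_etaBounds` divided by `(Z^∅)⁴`); and the window BUBBLE bound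
`τ(a₀a₁)τ(a₂a₃)·Σ_{u,v∈B_l} T₁(u,v)T₂(u,v) ≤ C₆·(Σ_{u∈B_l} τ⁴)²` (`stub_bubble_of_etaBounds` divided by `(Z^∅)⁸`).
The `let`-free registered spelling; definitionally the skeleton's `TwoPointInputs`. -/
theorem stub_twoPointInputs :
    ∀ η : ℝ, HasIsingEtaBounds 3 η → η < 1 / 2 →
      ∃ c₅ : ℝ, 0 < c₅ ∧ ∃ C₆ : ℝ, 0 < C₆ ∧ ∀ l : ℕ, 1 ≤ l → ∃ N₀ : ℕ, ∀ N : ℕ, N₀ ≤ N →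
        ∀ a : Fin 4 → ↥(box 3 N), (∀ i, ((a i : Site 3)) = (l : ℤ) • tetra i) →
        ((∀ u v : ↥(box 3 N), 0 ≤ isingTwoPoint ((zdGraph 3).comap (Subtype.val : ↥(box 3 N) → Site 3)) Finset.univ
            (criticalBeta 3) 0 .free u v) ∧
         0 < isingTwoPoint ((zdGraph 3).comap (Subtype.val : ↥(box 3 N) → Site 3)) Finset.univ
            (criticalBeta 3) 0 .free (a 0) (a 1) ∧
         0 < isingTwoPoint ((zdGraph 3).comap (Subtype.val : ↥(box 3 N) → Site 3)) Finset.univ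
            (criticalBeta 3) 0 .free (a 2) (a 3) ∧
         isingTwoPoint ((zdGraph 3).comap (Subtype.val : ↥(box 3 N) → Site 3)) Finset.univ
            (criticalBeta 3) 0 .free (a 0) (a 1) =
           isingCorr ((zdGraph 3).comap (Subtype.val : ↥(box 3 N) → Site 3)) Finset.univ
            (criticalBeta 3) 0 .free {a 0, a 1} ∧
         isingTwoPoint ((zdGraph 3).comap (Subtype.val : ↥(box 3 N) → Site 3)) Finset.univ
            (criticalBeta 3) 0 .free (a 2) (a 3) =
           isingCorr ((zdGraph 3).comap (Subtype.val : ↥(box 3 N) → Site 3)) Finset.univ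
            (criticalBeta 3) 0 .free {a 2, a 3} ∧
         c₅ * (isingTwoPoint ((zdGraph 3).comap (Subtype.val : ↥(box 3 N) → Site 3)) Finset.univ
              (criticalBeta 3) 0 .free (a 0) (a 1) *
            isingTwoPoint ((zdGraph 3).comap (Subtype.val : ↥(box 3 N) → Site 3)) Finset.univ
              (criticalBeta 3) 0 .free (a 2) (a 3)) ≤
           ∑ u ∈ window N l,
             isingTwoPoint ((zdGraph 3).comap (Subtype.val : ↥(box 3 N) → Site 3)) Finset.univ
                 (criticalBeta 3) 0 .free (a 0) u *
               isingTwoPoint ((zdGraph 3).comap (Subtype.val : ↥(box 3 N) → Site 3)) Finset.univ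
                 (criticalBeta 3) 0 .free u (a 1) *
               (isingTwoPoint ((zdGraph 3).comap (Subtype.val : ↥(box 3 N) → Site 3)) Finset.univ
                   (criticalBeta 3) 0 .free (a 2) u *
                 isingTwoPoint ((zdGraph 3).comap (Subtype.val : ↥(box 3 N) → Site 3)) Finset.univ
                   (criticalBeta 3) 0 .free u (a 3)) ∧
         isingTwoPoint ((zdGraph 3).comap (Subtype.val : ↥(box 3 N) → Site 3)) Finset.univ
              (criticalBeta 3) 0 .free (a 0) (a 1) *
            isingTwoPoint ((zdGraph 3).comap (Subtype.val : ↥(box 3 N) → Site 3)) Finset.univ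
              (criticalBeta 3) 0 .free (a 2) (a 3) *
            (∑ u ∈ window N l, ∑ v ∈ window N l,
              (isingTwoPoint ((zdGraph 3).comap (Subtype.val : ↥(box 3 N) → Site 3)) Finset.univ
                    (criticalBeta 3) 0 .free (a 0) u *
                  isingTwoPoint ((zdGraph 3).comap (Subtype.val : ↥(box 3 N) → Site 3)) Finset.univ
                    (criticalBeta 3) 0 .free u v *
                  isingTwoPoint ((zdGraph 3).comap (Subtype.val : ↥(box 3 N) → Site 3)) Finset.univ
                    (criticalBeta 3) 0 .free v (a 1) +
                isingTwoPoint ((zdGraph 3).comap (Subtype.val : ↥(box 3 N) → Site 3)) Finset.univ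
                    (criticalBeta 3) 0 .free (a 0) v *
                  isingTwoPoint ((zdGraph 3).comap (Subtype.val : ↥(box 3 N) → Site 3)) Finset.univ
                    (criticalBeta 3) 0 .free v u *
                  isingTwoPoint ((zdGraph 3).comap (Subtype.val : ↥(box 3 N) → Site 3)) Finset.univ
                    (criticalBeta 3) 0 .free u (a 1)) *
              (isingTwoPoint ((zdGraph 3).comap (Subtype.val : ↥(box 3 N) → Site 3)) Finset.univ
                    (criticalBeta 3) 0 .free (a 2) u *
                  isingTwoPoint ((zdGraph 3).comap (Subtype.val : ↥(box 3 N) → Site 3)) Finset.univ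
                    (criticalBeta 3) 0 .free u v *
                  isingTwoPoint ((zdGraph 3).comap (Subtype.val : ↥(box 3 N) → Site 3)) Finset.univ
                    (criticalBeta 3) 0 .free v (a 3) +
                isingTwoPoint ((zdGraph 3).comap (Subtype.val : ↥(box 3 N) → Site 3)) Finset.univ
                    (criticalBeta 3) 0 .free (a 2) v *
                  isingTwoPoint ((zdGraph 3).comap (Subtype.val : ↥(box 3 N) → Site 3)) Finset.univ
                    (criticalBeta 3) 0 .free v u *
                  isingTwoPoint ((zdGraph 3).comap (Subtype.val : ↥(box 3 N) → Site 3)) Finset.univ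
                    (criticalBeta 3) 0 .free u (a 3))) ≤
           C₆ * (∑ u ∈ window N l,
             isingTwoPoint ((zdGraph 3).comap (Subtype.val : ↥(box 3 N) → Site 3)) Finset.univ
                 (criticalBeta 3) 0 .free (a 0) u *
               isingTwoPoint ((zdGraph 3).comap (Subtype.val : ↥(box 3 N) → Site 3)) Finset.univ
                 (criticalBeta 3) 0 .free u (a 1) *
               (isingTwoPoint ((zdGraph 3).comap (Subtype.val : ↥(box 3 N) → Site 3)) Finset.univ
                   (criticalBeta 3) 0 .free (a 2) u *
                 isingTwoPoint ((zdGraph 3).comap (Subtype.val : ↥(box 3 N) → Site 3)) Finset.univ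
                   (criticalBeta 3) 0 .free u (a 3))) ^ 2) := by
  intro η hη hη2
  have hη0 : 0 ≤ η := StubTreeFloor.treeFloor_eta_nonneg hη
  obtain ⟨c₅, hc₅, hF⟩ := stub_treeFloor_of_etaBounds η hη hη2.le
  obtain ⟨C₆, hC₆, hB⟩ := stub_bubble_of_etaBounds hη hη0 hη2
  refine ⟨c₅, hc₅, C₆, hC₆, fun l hl => ?_⟩
  obtain ⟨N₁, hF⟩ := hF l hl
  obtain ⟨N₂, hB⟩ := hB l hl
  refine ⟨max N₁ N₂, fun N hN a ha => ?_⟩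
  have iF := hF N (le_of_max_le_left hN) a ha
  have iB := hB N (le_of_max_le_right hN) a ha
  dsimp only at iF iB
  have hinj : Function.Injective a := tetra_injective hl a ha
  have h01 : a 0 ≠ a 1 := hinj.ne (by decide)
  have h23 : a 2 ≠ a 3 := hinj.ne (by decide)
  -- the profile and the bubble in `τ_N` form, the two source pairs
  rw [tpi_profile_eq, tpi_pair_eq h01, tpi_pair_eq h23] at iF
  rw [tpi_profile_eq, tpi_bubbleSum_eq, tpi_pair_eq h01, tpi_pair_eq h23] at iB
  set G : SimpleGraph ↥(box 3 N) := (zdGraph 3).comap (Subtype.val : ↥(box 3 N) → Site 3) with hG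
  set Z0 : ℝ := loopO1PartitionFunction G (Real.tanh (criticalBeta 3)) ∅ with hZ0
  have hZ0pos : 0 < Z0 := tpi_Z0_pos
  refine ⟨fun u v => (tpi_tau_pos u v).le, tpi_tau_pos _ _, tpi_tau_pos _ _,
    isingTwoPoint_eq_isingCorr G Finset.univ (criticalBeta 3) 0 .free h01,
    isingTwoPoint_eq_isingCorr G Finset.univ (criticalBeta 3) 0 .free h23, ?_, ?_⟩
  · -- tree floor: divide by `(Z^∅)⁴`
    refine le_of_mul_le_mul_left ?_ (pow_pos hZ0pos 4)
    refine le_of_eq_of_le ?_ iF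
    ring
  · -- bubble: divide by `(Z^∅)⁸`
    refine le_of_mul_le_mul_left ?_ (pow_pos hZ0pos 8)
    refine le_of_eq_of_le ?_ (le_of_le_of_eq iB ?_) <;> ring

end Summit.CriticalPhenomena.Ising3DConformalLimit.Theorems

end
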